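import Summits.CriticalPhenomena.PercolationContinuityZ3.Theorems.PercNearOneGluingNoHeavyPcintVdBEDominating
import Summits.CriticalPhenomena.PercolationContinuityZ3.Theorems.PercNearOneGluingNoHeavyPcintKingRouteBridgeS
import Summits.CriticalPhenomena.PercolationContinuityZ3.Theorems.PercNearOneGluingNoHeavyPcintKingRouteBridgeStar
import Summits.CriticalPhenomena.PercolationContinuityZ3.Theorems.PercNearOneGluingNoHeavyPcintSiteZ4King
import Literature.Probability.Percolation.SiteSharpnessDecay
import HarnessLib

/-!
# PCINT lane, king route, K1 assembled: `p_c^site(ℤ²∗) ≤ 0.444`, hence `p_c^site(ℤ⁴) ≤ 0.444` unconditionally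

Cell `prim-pcint`, seat `prim-pcint-1` (gen 10); memo `run/shared/lean/prim/pcint/KING-ROUTE.md` §K1 (6).

Van den Berg–Ermakov (Random Struct. Alg. 8 (1996) 199–212, Thm. 1.1: `p_c^site(ℤ²) > 0.556`) compare site
percolation on `ℤ²` at `q = 0.556` with an exploration of the matching lattice `ℤ²∗` at `p = 0.444` through pair
states.  With the kernel tables (`…PcintVdBEDominance.lean`), the coupling-free domination theorem
(`AdaptDom.expect_le_of_dominating`) and its hypothesis discharged (`VdBEMarkov.dominating`), this file assembles the
comparison on boxes and passes to the limit:

* `KingRoute.sum_wt_reach_le_sum_muR_starPath` — the box inequality for the root rule `ε(o) = (1,1)`;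
* `KingRoute.exit_sq_le` — `P_q^{ℤ²}(0 ⟷ ∂B(n)) ≤ (2 / 0.444²) · P_p^{ℤ²∗}(0 ⟷ ∂B(n-2))`;
* `KingRoute.siteTheta_sq_le` — `θ^s_{ℤ²}(0.556) ≤ (2 / 0.444²) · θ^s_{ℤ²∗}(0.444)`;
* **`KingRoute.siteCriticalProb_star_le_0444`** — `p_c^site(ℤ²∗) ≤ 0.444` (if `θ_{ℤ²}(0.556) > 0` then
  `θ_{ℤ²∗}(0.444) > 0`; else `p_c^site(ℤ²) ≥ 0.556` and `p_c^site(ℤ²∗) ≤ 1 - p_c^site(ℤ²)`,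
  `siteCriticalProb_star_le_one_sub`);
* the UNCONDITIONAL rows `siteCriticalProb_Z4_le_0444` (`p_c^site(ℤ⁴) ≤ 0.444`, was `0.4685`),
  `siteCriticalProb_Z5_le_0425`, `siteCriticalProb_Z8_le_02544` (replacing the hypothesis rows of `…PcintSiteZ4King.lean`).
-/

noncomputable section

namespace Summit.CriticalPhenomena.PercolationContinuityZ3.Theorems.Pcint

namespace KingRoute

open Finset Filter Topology MeasureTheory AdaptDom ClusterExpl KingPairs VdBEProcess VdBEProcess11 VdBEMarkov VdBELocal
  Literature.Probability.Percolation Literature.Probability.LatticeModels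

/-- `q = 0.556` as a point of `[0, 1]`. -/
def qI : unitInterval := ⟨556 / 1000, by norm_num, by norm_num⟩

/-- `p = 0.444` as a point of `[0, 1]`. -/
def pI : unitInterval := ⟨444 / 1000, by norm_num, by norm_num⟩

/-! ### The box inequality for the root rule `ε(o) = (1,1)` -/

variable {Λ : Finset (Site 2)}

open Classical in
/-- **The comparison inequality on a box**, root rule `ε(o) = (1,1)` and weight `muR`: the `π_q`-probability that `o`
is joined to `B` by open sites of `Λ` is at most the `muR`-weight of the pair-state assignments with an open `∗`-path of
`cfg w` from the bottom site of the pair of `o` to a site of the pair of some `v ∈ B` (any ranking `enc`). -/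
theorem sum_wt_reach_le_sum_muR_starPath (enc : ↥Λ → ℕ) (o : ↥Λ) (B : Finset ↥Λ) :
    ∑ ω : ↥Λ → Bool, wt (556 / 1000) ω * reachIndicator (boxGraph Λ) o B ω ≤
      ∑ w : ↥Λ → Bool × Bool, muR Λ o w *
        (if ∃ v ∈ B, ∃ j : Bool, pairSite v.1 j ∈ cfg Λ w ∧
            PathIn zdStarGraph (cfg Λ w) (pairSite o.1 false) (pairSite v.1 j) then (1 : ℝ) else 0) := by
  set N := Fintype.card ↥Λ + 1 with hN
  let ω₀ : ↥Λ → Bool := fun _ => false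
  have h1 := expect_le_of_dominating (by norm_num) (by norm_num) (reachIndicator_mono (boxGraph Λ) o B)
    (rule (boxGraph Λ) enc o) (rule_unrevealed (boxGraph Λ) enc o) (muR Λ o) sum_muR (outVdBE11 Λ enc)
    (dominating enc o) N ω₀ (fun w ω => reach_determined (boxGraph Λ) enc o B (outVdBE11 Λ enc w) ω ω₀)
  refine h1.trans (Finset.sum_le_sum fun w _ => mul_le_mul_of_nonneg_left ?_ (muR_nonneg w))
  unfold reachIndicator
  split_ifs with hreach hpath
  · exact le_rfl
  · exfalso
    apply hpath
    have hval : reachIndicator (boxGraph Λ) o B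
        (merge (run (rule (boxGraph Λ) enc o) (outVdBE11 Λ enc w) N) ω₀) = 1 := by
      unfold reachIndicator; rw [if_pos hreach]
    obtain ⟨v, hvB, j, hj, hp⟩ := VdBEProcess11.exists_pathIn_star_of_reach (enc := enc) (o := o) w B ω₀ hval
    exact ⟨v, hvB, j, hj, hp⟩
  · norm_num
  · norm_num

/-- `muR ≤ pairWt / 0.444²`. -/
theorem muR_le_pairWt (o : ↥Λ) (w : ↥Λ → Bool × Bool) : muR Λ o w ≤ pairWt Λ (444 / 1000) w / mP (true, true) := by
  have hpw : pw (fun _ : ↥Λ => mP) w = pairWt Λ (444 / 1000) w := rfl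
  unfold muR
  rw [hpw]
  refine div_le_div_of_nonneg_right ?_ mP_tt_pos.le
  have h0 : 0 ≤ pairWt Λ (444 / 1000) w :=
    Finset.prod_nonneg fun v _ => mul_nonneg (bern_nonneg (by norm_num) (by norm_num) _)
      (bern_nonneg (by norm_num) (by norm_num) _)
  split_ifs <;> nlinarith

/-! ### From the box inequality to exit probabilities -/

/-- The bottom site of the pair of the origin is the origin. -/
theorem pairSite_zero_false : pairSite (0 : Site 2) false = 0 := by
  funext k; fin_cases k <;> simp [pairSite]

/-- A `∗`-path from `s` through pair sites of a box to a pair site of an inner-boundary site of `box 2 n` leaves the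
box `B' + s` of radius `n - 2` about `s`, for `s` with `|s k| ≤ 1`: it witnesses the exit event of `B' + s` at `s`. -/
theorem mem_exitEvent_of_pathIn {n : ℕ} (hn : 2 ≤ n) {ω : Set (Site 2)} {A : Set (Site 2)} {s : Site 2}
    (hs : ∀ k, |s k| ≤ 1) {v : Site 2} (hv : v ∈ innerBoundary (zdGraph 2) (box 2 n)) {j : Bool}
    (hp : PathIn zdStarGraph (ω ∩ A) s (pairSite v j)) :
    ω ∈ exitEvent zdStarGraph ((box 2 (n - 2)).image (· + s)) s := by
  classical
  set B' : Finset (Site 2) := (box 2 (n - 2)).image (· + s) with hB'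
  have hmemB' : ∀ x : Site 2, x ∈ B' ↔ ∀ k, -((n - 2 : ℕ) : ℤ) ≤ x k - s k ∧ x k - s k ≤ ((n - 2 : ℕ) : ℤ) := by
    intro x
    rw [hB', Finset.mem_image]
    constructor
    · rintro ⟨y, hy, rfl⟩ k
      have := (mem_box.1 hy) k
      simp only [Pi.add_apply, add_sub_cancel_right]; exact this
    · intro h
      refine ⟨x - s, mem_box.2 fun k => by simpa using h k, by simp⟩
  have hsB' : s ∈ B' := (hmemB' s).2 fun k => by simp
  -- the endpoint is outside `B'`
  have hvout : pairSite v j ∉ B' := by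
    intro h
    have h' := (hmemB' _).1 h
    obtain ⟨hvbox, y, hy, hadj⟩ := mem_innerBoundary_iff.1 hv
    -- some coordinate of `v` has absolute value `n`
    have hbig : ∃ k, (n : ℤ) ≤ |v k| := by
      by_contra hcon
      push Not at hcon
      apply hy
      rw [mem_box]
      have := WeakBeurling.coord_step_of_adj hadj
      have h0 := hcon 0; have h1 := hcon 1
      rw [abs_lt] at h0 h1
      intro k
      fin_cases k <;> simp only [Fin.zero_eta, Fin.mk_one, Fin.isValue] <;> omega
    obtain ⟨k, hk⟩ := hbig
    have hle := abs_le_pairSite_norm v j k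
    have hc0 := h' 0; have hc1 := h' 1
    have hs0 := hs 0; have hs1 := hs 1
    rw [abs_le] at hs0 hs1
    have : max |pairSite v j 0| |pairSite v j 1| ≤ (n : ℤ) - 1 := by
      refine max_le ?_ ?_ <;> rw [abs_le] <;> constructor <;> omega
    omega
  obtain ⟨a, b, ha, hb, hbω, hab, hpa⟩ := hp.exit (R := (↑B' : Set (Site 2))) (Finset.mem_coe.2 hsB')
    (fun h => hvout (Finset.mem_coe.1 h))
  rw [mem_exitEvent_iff]
  refine ⟨a, mem_innerBoundary_iff.2 ⟨Finset.mem_coe.1 ha, b, fun h => hb (Finset.mem_coe.2 h), hab⟩, ?_⟩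
  exact PathIn.mem_siteConnIn (hpa.mono fun x hx => ⟨hx.1, hx.2.1⟩)

/-- **The box inequality in terms of exit probabilities**:
`P_q^{ℤ²}(0 ⟷ ∂ⁱⁿ box n) ≤ (2 / 0.444²) · P_p^{ℤ²∗}(0 ⟷ ∂ⁱⁿ box (n-2))`. -/
theorem exit_sq_le {n : ℕ} (hn : 2 ≤ n) :
    (sitePercolation (Site 2) qI).real (exitEvent (zdGraph 2) (box 2 n) 0) ≤
      2 / mP (true, true) * (sitePercolation (Site 2) pI).real (exitEvent zdStarGraph (box 2 (n - 2)) 0) := by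
  classical
  set Λ := box 2 n with hΛ
  have h0 : (0 : Site 2) ∈ Λ := zero_mem_box 2 n
  set o : ↥Λ := ⟨0, h0⟩ with ho
  set B := Λ.attach.filter fun v => v.1 ∈ innerBoundary (zdGraph 2) Λ with hB
  let enc : ↥Λ → ℕ := fun _ => 0
  -- (a) square side
  have ha := real_exitEvent_le_sum_wt_reach h0 qI
  -- (b) domination
  have hb := sum_wt_reach_le_sum_muR_starPath enc o B
  -- (c) weight comparison and (d) the `∗` side
  have hc : ∑ w : ↥Λ → Bool × Bool, muR Λ o w *
        (if ∃ v ∈ B, ∃ j : Bool, pairSite v.1 j ∈ cfg Λ w ∧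
            PathIn zdStarGraph (cfg Λ w) (pairSite o.1 false) (pairSite v.1 j) then (1 : ℝ) else 0) ≤
      (1 / mP (true, true)) * (sitePercolation (Site 2) pI).real (starPathEvent Λ o B) := by
    have hd := sum_pairWt_starPath_le_real_starPathEvent (Λ := Λ) pI o B
    calc _ ≤ ∑ w : ↥Λ → Bool × Bool, pairWt Λ (444 / 1000) w / mP (true, true) *
          (if ∃ v ∈ B, ∃ i j : Bool, pairSite o.1 i ∈ cfg Λ w ∧ pairSite v.1 j ∈ cfg Λ w ∧
              PathIn zdStarGraph (cfg Λ w) (pairSite o.1 i) (pairSite v.1 j) then (1 : ℝ) else 0) := by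
          refine Finset.sum_le_sum fun w _ => ?_
          have hμ := muR_le_pairWt o w
          have hμ0 := muR_nonneg (Λ := Λ) (o := o) w
          by_cases h1 : ∃ v ∈ B, ∃ j : Bool, pairSite v.1 j ∈ cfg Λ w ∧
              PathIn zdStarGraph (cfg Λ w) (pairSite o.1 false) (pairSite v.1 j)
          · obtain ⟨v, hv, j, hj, hp⟩ := h1
            rw [if_pos ⟨v, hv, j, hj, hp⟩, if_pos ⟨v, hv, false, j, hp.left_mem, hj, hp⟩]
            linarith
          · rw [if_neg h1, mul_zero]
            exact mul_nonneg (le_trans hμ0 hμ) (by split_ifs <;> norm_num)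
      _ = (1 / mP (true, true)) * ∑ w : ↥Λ → Bool × Bool, pairWt Λ (pI : ℝ) w *
          (if ∃ v ∈ B, ∃ i j : Bool, pairSite o.1 i ∈ cfg Λ w ∧ pairSite v.1 j ∈ cfg Λ w ∧
              PathIn zdStarGraph (cfg Λ w) (pairSite o.1 i) (pairSite v.1 j) then (1 : ℝ) else 0) := by
          rw [Finset.mul_sum]
          exact Finset.sum_congr rfl fun w _ => by simp only [pI]; ring
      _ ≤ _ := mul_le_mul_of_nonneg_left hd (div_nonneg zero_le_one mP_tt_pos.le)
  -- (e) the `∗`-path event is contained in two exit events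
  have he : starPathEvent Λ o B ⊆ exitEvent zdStarGraph ((box 2 (n - 2)).image (· + pairSite (0 : Site 2) false))
      (pairSite (0 : Site 2) false) ∪
      exitEvent zdStarGraph ((box 2 (n - 2)).image (· + pairSite (0 : Site 2) true)) (pairSite (0 : Site 2) true) := by
    rintro ω ⟨v, hv, i, j, hp⟩
    have hv' : v.1 ∈ innerBoundary (zdGraph 2) (box 2 n) := (mem_filter.1 hv).2
    cases i
    · exact Or.inl (mem_exitEvent_of_pathIn hn (fun k => by fin_cases k <;> simp [pairSite]) hv' hp)
    · exact Or.inr (mem_exitEvent_of_pathIn hn (fun k => by fin_cases k <;> simp [pairSite]) hv' hp)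
  -- (f) union bound and translation invariance
  have hf : (sitePercolation (Site 2) pI).real (starPathEvent Λ o B) ≤
      2 * (sitePercolation (Site 2) pI).real (exitEvent zdStarGraph (box 2 (n - 2)) 0) := by
    refine (measureReal_mono he (measure_ne_top _ _)).trans ((measureReal_union_le _ _).trans ?_)
    rw [real_exitEvent_shift' zdStarGraph_adj_add_iff pI (box 2 (n - 2)) (pairSite (0 : Site 2) false),
      real_exitEvent_shift' zdStarGraph_adj_add_iff pI (box 2 (n - 2)) (pairSite (0 : Site 2) true)]
    linarith
  calc (sitePercolation (Site 2) qI).real (exitEvent (zdGraph 2) (box 2 n) 0)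
      ≤ ∑ ω : ↥Λ → Bool, wt (556 / 1000) ω * reachIndicator (boxGraph Λ) o B ω := ha
    _ ≤ _ := hb
    _ ≤ (1 / mP (true, true)) * (sitePercolation (Site 2) pI).real (starPathEvent Λ o B) := hc
    _ ≤ (1 / mP (true, true)) * (2 * (sitePercolation (Site 2) pI).real (exitEvent zdStarGraph (box 2 (n - 2)) 0)) :=
        mul_le_mul_of_nonneg_left hf (div_nonneg zero_le_one mP_tt_pos.le)
    _ = _ := by ring

/-! ### The limit and the case split -/

/-- **`θ^s_{ℤ²}(0.556) ≤ (2 / 0.444²) · θ^s_{ℤ²∗}(0.444)`.** -/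
theorem siteTheta_sq_le :
    siteTheta (zdGraph 2) (0 : Site 2) qI ≤ 2 / mP (true, true) * siteTheta zdStarGraph (0 : Site 2) pI := by
  -- `θ_{ℤ²}(q) ≤ P_q(exit box (m+2))` for every `m`
  have hup : ∀ m : ℕ, siteTheta (zdGraph 2) (0 : Site 2) qI ≤
      2 / mP (true, true) * (sitePercolation (Site 2) pI).real (exitEvent zdStarGraph (box 2 m) 0) := by
    intro m
    have h1 : siteTheta (zdGraph 2) (0 : Site 2) qI ≤ (sitePercolation (Site 2) qI).real (exitEvent (zdGraph 2) (box 2 (m + 2)) 0) :=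
      measureReal_mono (sitePercolatesAt_subset_exitEvent (zero_mem_box 2 (m + 2))) (measure_ne_top _ _)
    have h2 := exit_sq_le (n := m + 2) (by omega)
    simp only [Nat.add_sub_cancel] at h2
    exact h1.trans h2
  -- `P_p(exit box m) → θ_{ℤ²∗}(p)`
  have hlim := tendsto_siteTheta (G := zdStarGraph) (box_mono 2) exists_mem_box (x := (0 : Site 2)) (zero_mem_box 2 0) pI
  have heq : ∀ m : ℕ, (⋂ k ≤ m, exitEvent zdStarGraph (box 2 k) (0 : Site 2)) = exitEvent zdStarGraph (box 2 m) 0 := by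
    intro m
    apply Set.Subset.antisymm
    · intro ω hω; exact (Set.mem_iInter₂.1 hω) m le_rfl
    · exact Set.subset_iInter₂ fun k hk => exitEvent_anti (box_mono 2 hk) (zero_mem_box 2 k)
  simp_rw [heq] at hlim
  have hlim2 : Tendsto (fun m => 2 / mP (true, true) *
      (sitePercolation (Site 2) pI).real (exitEvent zdStarGraph (box 2 m) 0)) atTop
      (𝓝 (2 / mP (true, true) * siteTheta zdStarGraph (0 : Site 2) pI)) := hlim.const_mul _
  exact ge_of_tendsto' hlim2 hup

/-- **K1: `p_c^site(ℤ²∗) ≤ 0.444`, unconditionally** (van den Berg–Ermakov's comparison as a kernel theorem). -/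
theorem siteCriticalProb_star_le_0444 : siteCriticalProb zdStarGraph (0 : Site 2) ≤ 0.444 := by
  by_cases hθ : 0 < siteTheta (zdGraph 2) (0 : Site 2) qI
  · -- `θ_{ℤ²∗}(0.444) > 0`
    have hpos : 0 < siteTheta zdStarGraph (0 : Site 2) pI := by
      have h := siteTheta_sq_le
      have hc : 0 < 2 / mP (true, true) := div_pos two_pos mP_tt_pos
      nlinarith
    have := siteCriticalProb_le_of_siteTheta_pos zdStarGraph (0 : Site 2) hpos
    exact this.trans (by norm_num [pI])
  · -- `θ_{ℤ²}(0.556) = 0`, so `p_c^site(ℤ²) ≥ 0.556`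
    have hθ0 : siteTheta (zdGraph 2) (0 : Site 2) qI = 0 :=
      le_antisymm (not_lt.1 hθ) (by unfold siteTheta; exact measureReal_nonneg)
    have hq : (0.556 : ℝ) ≤ siteCriticalProb (zdGraph 2) (0 : Site 2) := by
      refine le_siteCriticalProb_of_forall (zdGraph 2) (0 : Site 2) (by norm_num) fun r hr => ?_
      by_contra hlt
      push Not at hlt
      have hmono := siteTheta_mono (G := zdGraph 2) (0 : Site 2) (show r ≤ qI from by
        change (r : ℝ) ≤ 556 / 1000; linarith)
      rw [hθ0] at hmono
      exact absurd hr (not_lt.2 hmono)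
    have := siteCriticalProb_star_le_one_sub
    linarith

/-! ### The unconditional rows -/

/-- **`p_c^site(ℤ⁴) ≤ 0.444`** (was `0.4685`): the covering `ℤ⁴ → ℤ²∗` and `p_c^site(ℤ²∗) ≤ 0.444`. -/
theorem siteCriticalProb_Z4_le_0444 : siteCriticalProb (zdGraph 4) (0 : Site 4) ≤ 0.444 :=
  KingCover.siteCriticalProb_Z4_le_star.trans siteCriticalProb_star_le_0444

/-- **`p_c^site(ℤ^d) ≤ 0.444` for every `d ≥ 4`.** -/
theorem siteCriticalProb_zd_le_0444 {d : ℕ} (hd : 4 ≤ d) : siteCriticalProb (zdGraph d) (0 : Site d) ≤ 0.444 :=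
  (KingCover.siteCriticalProb_zd_le_star hd).trans siteCriticalProb_star_le_0444

/-- **`p_c^site(ℤ⁵) ≤ 0.425`** (was `0.4477`): Gomes–Pereira–Sanchis's crossover coupling from `p_c^site(ℤ⁴) ≤ 0.444`
(`q = 0.076`, seven copies, detours of height `≤ 5`, gadget probability `0.44437 > 0.444`). -/
theorem siteCriticalProb_Z5_le_0425 : siteCriticalProb (zdGraph 5) (0 : Site 5) ≤ 0.425 := by
  have hq : (0.076 : ℝ) ∈ unitInterval := ⟨by norm_num, by norm_num⟩
  have hg : (0.444 : ℝ) < GPSCrossover.gadgetProb (0.076 : ℝ) 5 (2 * 4 - 1) := by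
    rw [GPSCrossover.gadgetProb]
    norm_num [Finset.sum_range_succ]
  have := GPSCrossover.siteCriticalProb_zd_succ_le_of_crossover (d := 4) (by norm_num) 5 ⟨0.076, hq⟩
    (siteCriticalProb_Z4_le_0444.trans_lt hg)
  refine this.trans ?_
  norm_num

/-- **`p_c^site(ℤ^d) ≤ 0.425` for every `d ≥ 5`.** -/
theorem siteCriticalProb_zd_le_0425 {d : ℕ} (hd : 5 ≤ d) : siteCriticalProb (zdGraph d) (0 : Site d) ≤ 0.425 :=
  (AxisGrouping.siteCriticalProb_zd_anti hd).trans siteCriticalProb_Z5_le_0425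

/-- **`p_c^site(ℤ⁸) ≤ 0.2544`** (was `0.271`): Gomes–Pereira–Sanchis's Lemma 2 with `k = 4`, `m = 2` from
`p_c^site(ℤ⁴) ≤ 0.444`: `1 - √(1 - 0.444) = 0.25435…`. -/
theorem siteCriticalProb_Z8_le_02544 : siteCriticalProb (zdGraph 8) (0 : Site 8) ≤ 0.2544 := by
  have h4 := siteCriticalProb_Z4_le_0444
  have h' := AxisGrouping.siteCriticalProb_zd_mul_le_real (k := 4) (m := 2) (t₀ := 0.2544) (by norm_num)
    fun t ht ht1 => by
      have h0 : 0 ≤ 1 - t := by linarith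
      have h2 : (1 - t) ^ 2 < (0.7456 : ℝ) ^ 2 := pow_lt_pow_left₀ (by linarith) h0 (by norm_num)
      norm_num at h2
      linarith
  exact h'

/-- **`p_c^site(ℤ^d) ≤ 0.2544` for every `d ≥ 8`.** -/
theorem siteCriticalProb_zd_le_02544 {d : ℕ} (hd : 8 ≤ d) : siteCriticalProb (zdGraph d) (0 : Site d) ≤ 0.2544 :=
  (AxisGrouping.siteCriticalProb_zd_anti hd).trans siteCriticalProb_Z8_le_02544

end KingRoute

end Summit.CriticalPhenomena.PercolationContinuityZ3.Theorems.Pcint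

end
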